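import Summits.HodgeConjecture.HodgeConjecture.Theorems.WeilTypeLadderTargetTransfer
import Literature.AlgebraicGeometry.HodgeTheory.FermatHodgeConjectureProducts
import HarnessLib

/-!
# WeilTypeLadder · CASE C18 with Shioda's product theorem as a NAMED FACT: the `ℤ/18` cyclotomic family over `(X²₁₈)³`

b2b cell `hweil` (packet `run/shared/lean/b2b/hodge-weil/`, report `b2b-hweil-pv3-g39/ORDERING-LEMMA.md` §3.6 and ADDENDUM B).
`Theorems/WeilTypeLadderTargetTransfer` typed CASE C18 with the algebraicity of the target's rational `(3,3)`-classes as a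
HYPOTHESIS `hXH`. Here the target is fixed to the one PROPOSITION CYC uses — `X' = (X₁ ⊗ X₂) ⊗ X₃`, `Xᵢ` smooth projective Fermat
SURFACES of degree `18` — and `hXH` is DISCHARGED BY NAME from the Literature fact
`hodgeClasses_algebraic_fermatProduct₃` (Shioda, Proc. Japan Acad. 55A (1979) p. 112, Thm. 2: the Hodge conjecture for arbitrary
products `X^{n₁}_m × ⋯ × X^{n_k}_m`, `m` prime or `≤ 20` — refereed, CITED, typed in `HodgeTheory/FermatHodgeConjectureProducts`).

* `nonsplitSixfolds_fermatSurfaceCubeTransfer_of_facts` / `_of_nonsplitSixfolds` / `_of_hodgeConjecture` — the body of R1′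
  (`NonsplitSixfolds`, every `d`, rung binders VERBATIM FIRST), then the datum `(X₁ X₂ X₃ T, Fermat surfaces of degree m with m prime
  or 1 < m ≤ 20, dim T = 6, a surjective, b : ι → (T ⟶ (X₁ ⊗ X₂) ⊗ X₃))`, then per class with
  `a^* c ∈ ⨆ᵢ (bᵢ)^*(span of the rational (3,3)-classes of (X₁ ⊗ X₂) ⊗ X₃)`: rational `(3,3)` in the Weil plane ⇒ algebraic —
  binders `(hF₃ : hodgeClasses_algebraic_fermatProduct₃) (hP : fulton1998_map_mem_algebraicClasses)`, both refereed named facts.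
* `nonsplitSixfolds_cyclicOctodecicPrym_fermat_of_facts` / `_of_nonsplitSixfolds` / `_of_hodgeConjecture` — the same on the NAMED
  `ℤ/18` family of `…TargetTransfer` (`α¹⁸ = 𝟙`, `Σ_{i<18} sⁱ = 0`, `B = kerComponent(𝟙 − s³ + s⁶)`, `t = s_B⁶`, `ψ₀ = t − t²`, `dim B = 6`)
  with `m = 18`: CASE C18 in the (CC) format of CL1/CL2 (named-fact binders + on-path lemma).

HONEST LABEL: the datum (every member of `y¹⁸ = (x−b₁)(x−b₂)⁴(x−b₃)⁴(x−b₄)⁹` carries `(T, a, b_S)` with partners in `M_K ⊂ H⁶((X²₁₈)³)`)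
is PROPOSITION CYC (pen-and-paper, packet); non-split-ness and `End⁰ = ℚ(ζ₉)` are the packet's THEOREM SCAN-CYC / PROPOSITION END;
0 unconditional rungs; conditional on [Shioda 1979 Thm. 2] + [Fulton 1998 Cor. 19.2 (b)] (refereed) and on the datum; Markman-free.
No `sorry`, no new definition, no new named fact.
-/

noncomputable section

-- every declaration of this problem lives in `Summit.HodgeConjecture.HodgeConjecture.…` (summit = sub-problem)
set_option linter.dupNamespace false

open CategoryTheory MonoidalCategory
open Literature.AlgebraicGeometry Literature.AlgebraicGeometry.Motives
open Literature.AlgebraicGeometry.HodgeTheory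
open Literature.AlgebraicTopology.SingularHomology

namespace Summit.HodgeConjecture.HodgeConjecture.WeilTypeLadder

/-! ### §1 R1′ on the locus dominated by a cube of Fermat surfaces, from the two facts -/

section FermatSurfaceCube

/-- **R1′ on the `(X²ₘ)³`-dominated locus, from the facts** (`m` prime or `1 < m ≤ 20`). The body of `NonsplitSixfolds` (rung
binders first and verbatim, every `d`), then the datum — three smooth projective Fermat surfaces `X₁, X₂, X₃` of degree `m`,
`T` smooth projective of dimension `6`, `a : T ⟶ A.X` surjective, `b : ι → (T ⟶ (X₁ ⊗ X₂) ⊗ X₃)` — then per class of the Weil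
plane with `a^* c` in the sum of the `bᵢ`-pull-backs of the span of the rational `(3,3)`-classes of `(X₁ ⊗ X₂) ⊗ X₃`: rational of
type `(3,3)` ⇒ algebraic. [cite: Shioda1979PJA, §2 Thm. 2 (p. 112) with the list after Thm. 1] [cite: Fulton1998, §19.2 Cor. 19.2 (b)] -/
theorem nonsplitSixfolds_fermatSurfaceCubeTransfer_of_facts
    (hF₃ : hodgeClasses_algebraic_fermatProduct₃) (hP : fulton1998_map_mem_algebraicClasses) :
    ∀ (d : ℕ), 0 < d → ∀ (A : Motives.AbelianVariety ℂ) (φ : A ⟶ A), A.dim = 2 * 3 →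
      Motives.IsSmoothProjective (2 * 3) A.X → φ ≫ φ = -(d • 𝟙 A) →
      (∀ (e : Motives.ProjectiveEmbedding A.X) (a : complexBetti (Motives.projectiveSpace e.n ℂ) 2),
        IsRationalClass a → a ≠ 0 →
          ¬ Motives.IsHyperbolicWeilType A φ 3
            ((d : ℂ) • complexBetti.map e.ι 2 a +
              complexBetti.map φ.hom.hom.hom 2 (complexBetti.map e.ι 2 a))) →
    ∀ (m : ℕ), m.Prime ∨ (1 < m ∧ m ≤ 20) → ∀ (X₁ X₂ X₃ T : Motives.SchemeOver ℂ),
      IsFermatVariety 2 m X₁ → IsSmoothProjective 2 X₁ → IsFermatVariety 2 m X₂ → IsSmoothProjective 2 X₂ →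
      IsFermatVariety 2 m X₃ → IsSmoothProjective 2 X₃ → IsSmoothProjective (2 * 3) T →
    ∀ (a : T ⟶ A.X), AlgebraicGeometry.Surjective a.left → ∀ (ι : Type) (b : ι → (T ⟶ (X₁ ⊗ X₂) ⊗ X₃)),
      ∀ c : complexBetti A.X (2 * 3),
        complexBetti.map a (2 * 3) c ∈ (⨆ i, (Submodule.span ℂ
            {x : complexBetti ((X₁ ⊗ X₂) ⊗ X₃) (2 * 3) |
              IsRationalClass x ∧ IsOfHodgeType (2 + 2 + 2) ((X₁ ⊗ X₂) ⊗ X₃) (2 * 3) 3 3 x}).map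
                (complexBetti.map (b i) (2 * 3)).hom) →
        IsRationalClass c → IsOfHodgeType (2 * 3) A.X (2 * 3) 3 3 c → c ∈ weilClassesOf A φ 3 d →
          c ∈ algebraicClasses A.X 3 := by
  intro d _ A φ hA _ _ _ m hm X₁ X₂ X₃ T hF₁ hX₁ hF₂ hX₂ hF₃' hX₃ hT a ha ι b c hc _ _ _
  exact abelianVariety_mem_algebraicClasses_of_targetTransferFamily hP A
    ((hX₁.tensor_holds hX₂).tensor_holds hX₃)
    (span_rational_hodge_le_algebraicClasses_fermatProduct₃ hF₃ hm hF₁ hX₁ hF₂ hX₂ hF₃' hX₃ 3) (hA ▸ hT) a b hc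

/-- **The same body from the rung R1′ itself** (`NonsplitSixfolds`; the datum is not used). -/
theorem nonsplitSixfolds_fermatSurfaceCubeTransfer_of_nonsplitSixfolds (h : NonsplitSixfolds) :
    ∀ (d : ℕ), 0 < d → ∀ (A : Motives.AbelianVariety ℂ) (φ : A ⟶ A), A.dim = 2 * 3 →
      Motives.IsSmoothProjective (2 * 3) A.X → φ ≫ φ = -(d • 𝟙 A) →
      (∀ (e : Motives.ProjectiveEmbedding A.X) (a : complexBetti (Motives.projectiveSpace e.n ℂ) 2),
        IsRationalClass a → a ≠ 0 →
          ¬ Motives.IsHyperbolicWeilType A φ 3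
            ((d : ℂ) • complexBetti.map e.ι 2 a +
              complexBetti.map φ.hom.hom.hom 2 (complexBetti.map e.ι 2 a))) →
    ∀ (m : ℕ), m.Prime ∨ (1 < m ∧ m ≤ 20) → ∀ (X₁ X₂ X₃ T : Motives.SchemeOver ℂ),
      IsFermatVariety 2 m X₁ → IsSmoothProjective 2 X₁ → IsFermatVariety 2 m X₂ → IsSmoothProjective 2 X₂ →
      IsFermatVariety 2 m X₃ → IsSmoothProjective 2 X₃ → IsSmoothProjective (2 * 3) T →
    ∀ (a : T ⟶ A.X), AlgebraicGeometry.Surjective a.left → ∀ (ι : Type) (b : ι → (T ⟶ (X₁ ⊗ X₂) ⊗ X₃)),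
      ∀ c : complexBetti A.X (2 * 3),
        complexBetti.map a (2 * 3) c ∈ (⨆ i, (Submodule.span ℂ
            {x : complexBetti ((X₁ ⊗ X₂) ⊗ X₃) (2 * 3) |
              IsRationalClass x ∧ IsOfHodgeType (2 + 2 + 2) ((X₁ ⊗ X₂) ⊗ X₃) (2 * 3) 3 3 x}).map
                (complexBetti.map (b i) (2 * 3)).hom) →
        IsRationalClass c → IsOfHodgeType (2 * 3) A.X (2 * 3) 3 3 c → c ∈ weilClassesOf A φ 3 d →
          c ∈ algebraicClasses A.X 3 := by
  intro d hd A φ hA hS hφ hnh _ _ _ _ _ _ _ _ _ _ _ _ _ _ _ _ _ c _ hr ht hw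
  exact h d hd A φ hA hS hφ hnh c hr ht hw

/-- **On-path lemma** (`HodgeConjecture → NonsplitSixfolds →` the `(X²ₘ)³`-dominated locus). -/
theorem nonsplitSixfolds_fermatSurfaceCubeTransfer_of_hodgeConjecture (h : _root_.HodgeConjecture) :
    ∀ (d : ℕ), 0 < d → ∀ (A : Motives.AbelianVariety ℂ) (φ : A ⟶ A), A.dim = 2 * 3 →
      Motives.IsSmoothProjective (2 * 3) A.X → φ ≫ φ = -(d • 𝟙 A) →
      (∀ (e : Motives.ProjectiveEmbedding A.X) (a : complexBetti (Motives.projectiveSpace e.n ℂ) 2),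
        IsRationalClass a → a ≠ 0 →
          ¬ Motives.IsHyperbolicWeilType A φ 3
            ((d : ℂ) • complexBetti.map e.ι 2 a +
              complexBetti.map φ.hom.hom.hom 2 (complexBetti.map e.ι 2 a))) →
    ∀ (m : ℕ), m.Prime ∨ (1 < m ∧ m ≤ 20) → ∀ (X₁ X₂ X₃ T : Motives.SchemeOver ℂ),
      IsFermatVariety 2 m X₁ → IsSmoothProjective 2 X₁ → IsFermatVariety 2 m X₂ → IsSmoothProjective 2 X₂ →
      IsFermatVariety 2 m X₃ → IsSmoothProjective 2 X₃ → IsSmoothProjective (2 * 3) T →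
    ∀ (a : T ⟶ A.X), AlgebraicGeometry.Surjective a.left → ∀ (ι : Type) (b : ι → (T ⟶ (X₁ ⊗ X₂) ⊗ X₃)),
      ∀ c : complexBetti A.X (2 * 3),
        complexBetti.map a (2 * 3) c ∈ (⨆ i, (Submodule.span ℂ
            {x : complexBetti ((X₁ ⊗ X₂) ⊗ X₃) (2 * 3) |
              IsRationalClass x ∧ IsOfHodgeType (2 + 2 + 2) ((X₁ ⊗ X₂) ⊗ X₃) (2 * 3) 3 3 x}).map
                (complexBetti.map (b i) (2 * 3)).hom) →
        IsRationalClass c → IsOfHodgeType (2 * 3) A.X (2 * 3) 3 3 c → c ∈ weilClassesOf A φ 3 d →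
          c ∈ algebraicClasses A.X 3 :=
  nonsplitSixfolds_fermatSurfaceCubeTransfer_of_nonsplitSixfolds (nonsplitSixfolds_of_hodgeConjecture h)

end FermatSurfaceCube

/-! ### §2 CASE C18: the named `ℤ/18` family over `(X²₁₈)³`, from the two facts -/

section CyclicOctodecicFermat

/-- **CASE C18 from the two named facts.** The `ℤ/18` family of `…TargetTransfer` (binders `C 𝒥 α`, `IsSmoothProjective 1 C`,
`α¹⁸ = 𝟙`, `s = α_*`, `Σ_{i<18} sⁱ = 0`, `B := kerComponent (𝟙 − s³ + s⁶)`, `sB`, `t = sB⁶`, `ψ₀ = t − t²`, `B.dim = 6`, then the rung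
binders at `d = 3`), then the datum with target `(X₁ ⊗ X₂) ⊗ X₃`, `Xᵢ` smooth projective Fermat surfaces of degree `18`, then the
per-class conclusion on `weilClassesOf B ψ₀ 3 3` — binders `(hF₃ : hodgeClasses_algebraic_fermatProduct₃)`, `(hP : fulton…)`.
[cite: Shioda1979PJA, §2 Thm. 2 (p. 112) with the list after Thm. 1] [cite: Fulton1998, §19.2 Cor. 19.2 (b)]
[cite: Schoen1988HodgeWeil, §1 Lemma 1.2, Lemma 1.5, Cor. 1.9] -/
theorem nonsplitSixfolds_cyclicOctodecicPrym_fermat_of_facts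
    (hF₃ : hodgeClasses_algebraic_fermatProduct₃) (hP : fulton1998_map_mem_algebraicClasses) :
    ∀ (C : Motives.SchemeOver ℂ) (𝒥 : Jacobian C) (α : C ⟶ C),
      IsSmoothProjective 1 C → CategoryTheory.End.of α ^ 18 = 1 →
    ∀ (s : 𝒥.J ⟶ 𝒥.J), s = 𝒥.pushforward 𝒥 α →
      (∑ i ∈ Finset.range 18, CategoryTheory.End.of s ^ i) = 0 →
    ∀ (sB t ψ₀ : AbelianVariety.kerComponent (𝟙 𝒥.J - s ≫ s ≫ s + s ≫ s ≫ s ≫ s ≫ s ≫ s) ⟶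
        AbelianVariety.kerComponent (𝟙 𝒥.J - s ≫ s ≫ s + s ≫ s ≫ s ≫ s ≫ s ≫ s)),
      sB ≫ AbelianVariety.kerComponentι (𝟙 𝒥.J - s ≫ s ≫ s + s ≫ s ≫ s ≫ s ≫ s ≫ s) =
        AbelianVariety.kerComponentι (𝟙 𝒥.J - s ≫ s ≫ s + s ≫ s ≫ s ≫ s ≫ s ≫ s) ≫ s →
      t = sB ≫ sB ≫ sB ≫ sB ≫ sB ≫ sB → ψ₀ = t - t ≫ t →
      (AbelianVariety.kerComponent (𝟙 𝒥.J - s ≫ s ≫ s + s ≫ s ≫ s ≫ s ≫ s ≫ s)).dim = 2 * 3 →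
      IsSmoothProjective (2 * 3) (AbelianVariety.kerComponent (𝟙 𝒥.J - s ≫ s ≫ s + s ≫ s ≫ s ≫ s ≫ s ≫ s)).X →
      ψ₀ ≫ ψ₀ = -((3 : ℕ) • 𝟙 _) →
      (∀ (e : Motives.ProjectiveEmbedding
          (AbelianVariety.kerComponent (𝟙 𝒥.J - s ≫ s ≫ s + s ≫ s ≫ s ≫ s ≫ s ≫ s)).X)
        (a : complexBetti (Motives.projectiveSpace e.n ℂ) 2), IsRationalClass a → a ≠ 0 →
          ¬ Motives.IsHyperbolicWeilType
              (AbelianVariety.kerComponent (𝟙 𝒥.J - s ≫ s ≫ s + s ≫ s ≫ s ≫ s ≫ s ≫ s)) ψ₀ 3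
            (((3 : ℕ) : ℂ) • complexBetti.map e.ι 2 a +
              complexBetti.map ψ₀.hom.hom.hom 2 (complexBetti.map e.ι 2 a))) →
    ∀ (X₁ X₂ X₃ T : Motives.SchemeOver ℂ),
      IsFermatVariety 2 18 X₁ → IsSmoothProjective 2 X₁ → IsFermatVariety 2 18 X₂ → IsSmoothProjective 2 X₂ →
      IsFermatVariety 2 18 X₃ → IsSmoothProjective 2 X₃ → IsSmoothProjective (2 * 3) T →
    ∀ (a : T ⟶ (AbelianVariety.kerComponent (𝟙 𝒥.J - s ≫ s ≫ s + s ≫ s ≫ s ≫ s ≫ s ≫ s)).X),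
      AlgebraicGeometry.Surjective a.left → ∀ (ι : Type) (b : ι → (T ⟶ (X₁ ⊗ X₂) ⊗ X₃)),
      ∀ c : complexBetti (AbelianVariety.kerComponent (𝟙 𝒥.J - s ≫ s ≫ s + s ≫ s ≫ s ≫ s ≫ s ≫ s)).X (2 * 3),
        complexBetti.map a (2 * 3) c ∈ (⨆ i, (Submodule.span ℂ
            {x : complexBetti ((X₁ ⊗ X₂) ⊗ X₃) (2 * 3) |
              IsRationalClass x ∧ IsOfHodgeType (2 + 2 + 2) ((X₁ ⊗ X₂) ⊗ X₃) (2 * 3) 3 3 x}).map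
                (complexBetti.map (b i) (2 * 3)).hom) →
        IsRationalClass c →
        IsOfHodgeType (2 * 3) (AbelianVariety.kerComponent (𝟙 𝒥.J - s ≫ s ≫ s + s ≫ s ≫ s ≫ s ≫ s ≫ s)).X
          (2 * 3) 3 3 c →
        c ∈ weilClassesOf (AbelianVariety.kerComponent (𝟙 𝒥.J - s ≫ s ≫ s + s ≫ s ≫ s ≫ s ≫ s ≫ s)) ψ₀ 3 3 →
        c ∈ algebraicClasses (AbelianVariety.kerComponent (𝟙 𝒥.J - s ≫ s ≫ s + s ≫ s ≫ s ≫ s ≫ s ≫ s)).X 3 := by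
  intro C 𝒥 α _ _ s _ _ sB t ψ₀ _ _ _ hB _ _ _ X₁ X₂ X₃ T hF₁ hX₁ hF₂ hX₂ hF₃' hX₃ hT a ha ι b c hc _ _ _
  exact abelianVariety_mem_algebraicClasses_of_targetTransferFamily hP _
    ((hX₁.tensor_holds hX₂).tensor_holds hX₃)
    (span_rational_hodge_le_algebraicClasses_fermatProduct₃ hF₃ (Or.inr ⟨by norm_num, by norm_num⟩)
      hF₁ hX₁ hF₂ hX₂ hF₃' hX₃ 3) (hB ▸ hT) a b hc

/-- **The same body from the rung R1′ itself** (`NonsplitSixfolds` at `d = 3`, `(A, φ) := (B, ψ₀)`; family and datum not used):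
the non-split members of the `ℤ/18` family are a CASE of the rung. -/
theorem nonsplitSixfolds_cyclicOctodecicPrym_fermat_of_nonsplitSixfolds (h : NonsplitSixfolds) :
    ∀ (C : Motives.SchemeOver ℂ) (𝒥 : Jacobian C) (α : C ⟶ C),
      IsSmoothProjective 1 C → CategoryTheory.End.of α ^ 18 = 1 →
    ∀ (s : 𝒥.J ⟶ 𝒥.J), s = 𝒥.pushforward 𝒥 α →
      (∑ i ∈ Finset.range 18, CategoryTheory.End.of s ^ i) = 0 →
    ∀ (sB t ψ₀ : AbelianVariety.kerComponent (𝟙 𝒥.J - s ≫ s ≫ s + s ≫ s ≫ s ≫ s ≫ s ≫ s) ⟶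
        AbelianVariety.kerComponent (𝟙 𝒥.J - s ≫ s ≫ s + s ≫ s ≫ s ≫ s ≫ s ≫ s)),
      sB ≫ AbelianVariety.kerComponentι (𝟙 𝒥.J - s ≫ s ≫ s + s ≫ s ≫ s ≫ s ≫ s ≫ s) =
        AbelianVariety.kerComponentι (𝟙 𝒥.J - s ≫ s ≫ s + s ≫ s ≫ s ≫ s ≫ s ≫ s) ≫ s →
      t = sB ≫ sB ≫ sB ≫ sB ≫ sB ≫ sB → ψ₀ = t - t ≫ t →
      (AbelianVariety.kerComponent (𝟙 𝒥.J - s ≫ s ≫ s + s ≫ s ≫ s ≫ s ≫ s ≫ s)).dim = 2 * 3 →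
      IsSmoothProjective (2 * 3) (AbelianVariety.kerComponent (𝟙 𝒥.J - s ≫ s ≫ s + s ≫ s ≫ s ≫ s ≫ s ≫ s)).X →
      ψ₀ ≫ ψ₀ = -((3 : ℕ) • 𝟙 _) →
      (∀ (e : Motives.ProjectiveEmbedding
          (AbelianVariety.kerComponent (𝟙 𝒥.J - s ≫ s ≫ s + s ≫ s ≫ s ≫ s ≫ s ≫ s)).X)
        (a : complexBetti (Motives.projectiveSpace e.n ℂ) 2), IsRationalClass a → a ≠ 0 →
          ¬ Motives.IsHyperbolicWeilType
              (AbelianVariety.kerComponent (𝟙 𝒥.J - s ≫ s ≫ s + s ≫ s ≫ s ≫ s ≫ s ≫ s)) ψ₀ 3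
            (((3 : ℕ) : ℂ) • complexBetti.map e.ι 2 a +
              complexBetti.map ψ₀.hom.hom.hom 2 (complexBetti.map e.ι 2 a))) →
    ∀ (X₁ X₂ X₃ T : Motives.SchemeOver ℂ),
      IsFermatVariety 2 18 X₁ → IsSmoothProjective 2 X₁ → IsFermatVariety 2 18 X₂ → IsSmoothProjective 2 X₂ →
      IsFermatVariety 2 18 X₃ → IsSmoothProjective 2 X₃ → IsSmoothProjective (2 * 3) T →
    ∀ (a : T ⟶ (AbelianVariety.kerComponent (𝟙 𝒥.J - s ≫ s ≫ s + s ≫ s ≫ s ≫ s ≫ s ≫ s)).X),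
      AlgebraicGeometry.Surjective a.left → ∀ (ι : Type) (b : ι → (T ⟶ (X₁ ⊗ X₂) ⊗ X₃)),
      ∀ c : complexBetti (AbelianVariety.kerComponent (𝟙 𝒥.J - s ≫ s ≫ s + s ≫ s ≫ s ≫ s ≫ s ≫ s)).X (2 * 3),
        complexBetti.map a (2 * 3) c ∈ (⨆ i, (Submodule.span ℂ
            {x : complexBetti ((X₁ ⊗ X₂) ⊗ X₃) (2 * 3) |
              IsRationalClass x ∧ IsOfHodgeType (2 + 2 + 2) ((X₁ ⊗ X₂) ⊗ X₃) (2 * 3) 3 3 x}).map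
                (complexBetti.map (b i) (2 * 3)).hom) →
        IsRationalClass c →
        IsOfHodgeType (2 * 3) (AbelianVariety.kerComponent (𝟙 𝒥.J - s ≫ s ≫ s + s ≫ s ≫ s ≫ s ≫ s ≫ s)).X
          (2 * 3) 3 3 c →
        c ∈ weilClassesOf (AbelianVariety.kerComponent (𝟙 𝒥.J - s ≫ s ≫ s + s ≫ s ≫ s ≫ s ≫ s ≫ s)) ψ₀ 3 3 →
        c ∈ algebraicClasses (AbelianVariety.kerComponent (𝟙 𝒥.J - s ≫ s ≫ s + s ≫ s ≫ s ≫ s ≫ s ≫ s)).X 3 := by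
  intro C 𝒥 α _ _ s _ _ sB t ψ₀ _ _ _ hB hS hψ hnh _ _ _ _ _ _ _ _ _ _ _ _ _ _ _ c _ hr ht hw
  exact h 3 (by norm_num) _ ψ₀ hB hS (by simpa using hψ) hnh c hr ht hw

/-- **On-path lemma**: `HodgeConjecture → NonsplitSixfolds →` CASE C18 over `(X²₁₈)³`. -/
theorem nonsplitSixfolds_cyclicOctodecicPrym_fermat_of_hodgeConjecture (h : _root_.HodgeConjecture) :
    ∀ (C : Motives.SchemeOver ℂ) (𝒥 : Jacobian C) (α : C ⟶ C),
      IsSmoothProjective 1 C → CategoryTheory.End.of α ^ 18 = 1 →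
    ∀ (s : 𝒥.J ⟶ 𝒥.J), s = 𝒥.pushforward 𝒥 α →
      (∑ i ∈ Finset.range 18, CategoryTheory.End.of s ^ i) = 0 →
    ∀ (sB t ψ₀ : AbelianVariety.kerComponent (𝟙 𝒥.J - s ≫ s ≫ s + s ≫ s ≫ s ≫ s ≫ s ≫ s) ⟶
        AbelianVariety.kerComponent (𝟙 𝒥.J - s ≫ s ≫ s + s ≫ s ≫ s ≫ s ≫ s ≫ s)),
      sB ≫ AbelianVariety.kerComponentι (𝟙 𝒥.J - s ≫ s ≫ s + s ≫ s ≫ s ≫ s ≫ s ≫ s) =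
        AbelianVariety.kerComponentι (𝟙 𝒥.J - s ≫ s ≫ s + s ≫ s ≫ s ≫ s ≫ s ≫ s) ≫ s →
      t = sB ≫ sB ≫ sB ≫ sB ≫ sB ≫ sB → ψ₀ = t - t ≫ t →
      (AbelianVariety.kerComponent (𝟙 𝒥.J - s ≫ s ≫ s + s ≫ s ≫ s ≫ s ≫ s ≫ s)).dim = 2 * 3 →
      IsSmoothProjective (2 * 3) (AbelianVariety.kerComponent (𝟙 𝒥.J - s ≫ s ≫ s + s ≫ s ≫ s ≫ s ≫ s ≫ s)).X →
      ψ₀ ≫ ψ₀ = -((3 : ℕ) • 𝟙 _) →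
      (∀ (e : Motives.ProjectiveEmbedding
          (AbelianVariety.kerComponent (𝟙 𝒥.J - s ≫ s ≫ s + s ≫ s ≫ s ≫ s ≫ s ≫ s)).X)
        (a : complexBetti (Motives.projectiveSpace e.n ℂ) 2), IsRationalClass a → a ≠ 0 →
          ¬ Motives.IsHyperbolicWeilType
              (AbelianVariety.kerComponent (𝟙 𝒥.J - s ≫ s ≫ s + s ≫ s ≫ s ≫ s ≫ s ≫ s)) ψ₀ 3
            (((3 : ℕ) : ℂ) • complexBetti.map e.ι 2 a +
              complexBetti.map ψ₀.hom.hom.hom 2 (complexBetti.map e.ι 2 a))) →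
    ∀ (X₁ X₂ X₃ T : Motives.SchemeOver ℂ),
      IsFermatVariety 2 18 X₁ → IsSmoothProjective 2 X₁ → IsFermatVariety 2 18 X₂ → IsSmoothProjective 2 X₂ →
      IsFermatVariety 2 18 X₃ → IsSmoothProjective 2 X₃ → IsSmoothProjective (2 * 3) T →
    ∀ (a : T ⟶ (AbelianVariety.kerComponent (𝟙 𝒥.J - s ≫ s ≫ s + s ≫ s ≫ s ≫ s ≫ s ≫ s)).X),
      AlgebraicGeometry.Surjective a.left → ∀ (ι : Type) (b : ι → (T ⟶ (X₁ ⊗ X₂) ⊗ X₃)),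
      ∀ c : complexBetti (AbelianVariety.kerComponent (𝟙 𝒥.J - s ≫ s ≫ s + s ≫ s ≫ s ≫ s ≫ s ≫ s)).X (2 * 3),
        complexBetti.map a (2 * 3) c ∈ (⨆ i, (Submodule.span ℂ
            {x : complexBetti ((X₁ ⊗ X₂) ⊗ X₃) (2 * 3) |
              IsRationalClass x ∧ IsOfHodgeType (2 + 2 + 2) ((X₁ ⊗ X₂) ⊗ X₃) (2 * 3) 3 3 x}).map
                (complexBetti.map (b i) (2 * 3)).hom) →
        IsRationalClass c →
        IsOfHodgeType (2 * 3) (AbelianVariety.kerComponent (𝟙 𝒥.J - s ≫ s ≫ s + s ≫ s ≫ s ≫ s ≫ s ≫ s)).X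
          (2 * 3) 3 3 c →
        c ∈ weilClassesOf (AbelianVariety.kerComponent (𝟙 𝒥.J - s ≫ s ≫ s + s ≫ s ≫ s ≫ s ≫ s ≫ s)) ψ₀ 3 3 →
        c ∈ algebraicClasses (AbelianVariety.kerComponent (𝟙 𝒥.J - s ≫ s ≫ s + s ≫ s ≫ s ≫ s ≫ s ≫ s)).X 3 :=
  nonsplitSixfolds_cyclicOctodecicPrym_fermat_of_nonsplitSixfolds (nonsplitSixfolds_of_hodgeConjecture h)

end CyclicOctodecicFermat

end Summit.HodgeConjecture.HodgeConjecture.WeilTypeLadder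

end
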